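import Literature.Computability.Learning.PAC
import Literature.Computability.Cryptography.PseudorandomFunctions
import HarnessLib

/-!
# Cryptographic hardness of learning: pseudorandom functions are not learnable

Named fact (D-0014) requested by route PneNP/Learning (converse direction of crux #3, `wi-03895`):
the classical observation (Goldreich–Goldwasser–Micali 1986; Kearns–Valiant 1994) that a
polynomial-time learner — even with membership queries, under the uniform distribution — for a
class of Boolean functions containing a pseudorandom function family would DISTINGUISH the family
from a random function; hence such classes are not polynomially learnable. Oliveira–Santhanam
(CCC 2017, §4) print it as: "It is well-known that the existence of learning algorithms for a
circuit class `𝒞ₙ[s(n)]` implies that there are no secure pseudorandom function families in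
`𝒞ₙ[s(n)]`" (citing Kearns–Valiant 1994), and formally, for randomised oracle CIRCUITS, as their
Prop. 1 ("Learning `𝔆` implies no PRFs in `𝔆`").

We record the statement in the tree's UNIFORM framework: PRFs are `Literature.Computability.Cryptography.IsPRF`
(security against PPT oracle adversaries, negligible advantage), learners are
`Literature.Learning.PolyPACPredictable uniformDistributions true` (polynomial-time learner with
membership queries and uniform examples, polynomially evaluatable hypotheses — REQUIRES the
two-phase learner/evaluator form of `PAC.lean`, in which the evaluator has no oracle).

* `FunctionEnsemble.boolFn F n k` — the Boolean function `x ↦` first bit of `F n k x` on `{0,1}ⁿ`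
  (input length `ℓin = id`).
* Fact `prf_not_polyPACPredictable`: if `F` is a PRF with `ℓin = id` and `ℓout ≥ 1`, and every
  keyed function `F.boolFn n k` (`|k| = κ n`) lies in the concept class `𝒞 n`, then `𝒞` is not
  `PolyPACPredictable` with membership queries under the uniform distribution. (Typical use:
  `𝒞 = sizeClass B2 (n ↦ n^c)`.)

Why this instance is implied by the printed observation: a `PolyPACPredictable` learner `(A, E)`
run at `ε = δ = 1/8`, answering its example/membership queries with the challenge oracle `𝒪`
(first output bit) and then testing the learned hypothesis `evalHyp E _ w` against `𝒪` on
`poly(n)` fresh uniform points, is a PPT oracle adversary; on `𝒪 = F n k` it accepts with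
probability `≥ 3/4 - o(1)`, on a uniformly random `𝒪` (whose first bit is a random Boolean
function, `ℓout ≥ 1`) the fresh labels are independent fair coins outside the `poly(n)` queried
points, so it accepts with probability `≤ 1/4 + o(1)`: constant advantage, contradicting `IsPRF`.
The hypothesis `ℓout ≥ 1` is necessary (for `ℓout = 0` both `IsPRF` and learnability hold).

## References

* O. Goldreich, S. Goldwasser, S. Micali, *How to construct random functions*, J. ACM 33 (1986)
  792–807 [GoldreichGoldwasserMicali1986].
* M. Kearns, L. Valiant, *Cryptographic limitations on learning Boolean formulae and finite
  automata*, J. ACM 41 (1994) 67–95 [KearnsValiant1994].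
* I. C. Oliveira, R. Santhanam, *Conspiracies between learning algorithms, circuit lower bounds,
  and pseudorandomness*, CCC 2017; arXiv:1611.01190, §4, Prop. 1 [OliveiraSanthanam2017].
-/

noncomputable section

namespace Literature.Computability.Learning

open Complexity Cryptography

/-- The keyed Boolean function on `{0,1}ⁿ` defined by a function ensemble with input length `n`:
the first output bit of `F n k` (junk `false` on empty output). [GGM 1986, §3 (`f_k`);
Oliveira–Santhanam 2017, Def. of PRF families in `𝒞[s]`] [folklore] -/
def _root_.Literature.Computability.Cryptography.FunctionEnsemble.boolFn (F : FunctionEnsemble) (n : ℕ)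
    (k : List Bool) : (Fin n → Bool) → Bool :=
  fun x => (F n k (List.ofFn x)).headD false

/-- **Pseudorandom function families are not polynomially learnable** (GGM 1986; Kearns–Valiant
1994; Oliveira–Santhanam 2017, §4 and Prop. 1 — uniform PPT instance, see the module docstring):
if `F` is a PRF on `n`-bit inputs with at least one output bit and all its keyed Boolean functions
belong to the concept class `𝒞`, then `𝒞` is not PAC learnable in polynomial time with
polynomially evaluatable hypotheses, membership queries and uniform examples.
[cite: OliveiraSanthanam2017, §4 Prop. 1] -/
def prf_not_polyPACPredictable : Prop :=
  ∀ (F : FunctionEnsemble) (κ ℓout : ℕ → ℕ), IsPRF F κ id ℓout → (∀ n, 1 ≤ ℓout n) →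
    ∀ 𝒞 : ConceptClass, (∀ (n : ℕ) (k : List Bool), k.length = κ n → F.boolFn n k ∈ 𝒞 n) →
      ¬ PolyPACPredictable uniformDistributions true 𝒞

/-- Contrapositive packaging for the Learning route: if `sizeClass B2 s` IS polynomially learnable
(MQ, uniform), then no PRF with `ℓin = id`, `ℓout ≥ 1` has all its keyed functions computable by
`B₂`-circuits of size `≤ s n`. [folklore] -/
theorem prf_not_polyPACPredictable.no_prf_in_sizeClass (h : prf_not_polyPACPredictable)
    {s : ℕ → ℕ} (hL : PolyPACPredictable uniformDistributions true (sizeClass B2 s))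
    (F : FunctionEnsemble) (κ ℓout : ℕ → ℕ) (hout : ∀ n, 1 ≤ ℓout n)
    (hF : ∀ (n : ℕ) (k : List Bool), k.length = κ n → F.boolFn n k ∈ sizeClass B2 s n) :
    ¬ IsPRF F κ id ℓout :=
  fun hprf => h F κ ℓout hprf hout _ hF hL

/-- Learnability of a class transfers hardness to every superclass: if `𝒞 ⊆ 𝒞'` pointwise and `𝒞`
contains a PRF, then `𝒞'` is not polynomially learnable either. [folklore] -/
theorem prf_not_polyPACPredictable.mono (h : prf_not_polyPACPredictable) (F : FunctionEnsemble)
    (κ ℓout : ℕ → ℕ) (hprf : IsPRF F κ id ℓout) (hout : ∀ n, 1 ≤ ℓout n) {𝒞 𝒞' : ConceptClass}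
    (hF : ∀ (n : ℕ) (k : List Bool), k.length = κ n → F.boolFn n k ∈ 𝒞 n) (h𝒞 : ∀ n, 𝒞 n ⊆ 𝒞' n) :
    ¬ PolyPACPredictable uniformDistributions true 𝒞' :=
  fun hL => h F κ ℓout hprf hout 𝒞 hF (hL.mono h𝒞 fun _ => subset_rfl)

end Literature.Computability.Learning

end
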